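import Summits.CriticalPhenomena.PercolationContinuityZ3.Theorems.FK.BoxLimitSemicontinuity
import Summits.CriticalPhenomena.PercolationContinuityZ3.Theorems.FK.FreeWiredCoincidence
import HarnessLib

/-!
# FK-continuity cell, FO-10a: `φ⁰_{p,q} = φ¹_{p,q}` iff the edge density `h⁰(·,q)` (equivalently `h¹(·,q)`) is
# continuous at `p` — Grimmett 2006, Thm. (4.63) (b) ⟺ (c) ⟺ (d): the one-sided limits `h⁰(p+) = h¹(p)`, `h¹(p−) = h⁰(p)`

Registered R77 (cell INBOX l.5711, 2026-08-23); registry row FO-10a-g336h; label LHT-A (coordinator fk-4 g167).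
Cell `fk-continuity` (bschramm), row FO-10a (domain-Markov + comparison layer over FO-06); support file for the
FK-continuity transplant (`--supports stmt-CriticalPhenomena-4575`); builds on p205010 (kernel theorem, internal audit
signed; external expert review pending). Pure proofs; no definitions, no named facts, no sorries; general dimension `d`.

Grimmett 2006, Thm. (4.63): for `0 < p < 1`, `q ≥ 1` the following are equivalent — (b)(i) `x ↦ h⁰(x,q)` is continuous at
`x = p`; (b)(ii) `x ↦ h¹(x,q)` is continuous at `x = p`; (c) `h⁰(p,q) = h¹(p,q)`; (d) a unique random-cluster measure.
The tree has (c) ⟺ (d) (FO-07b `FreeWiredCoincidence.lean`: `rcLimit_false_eq_rcLimit_true_iff_of_mem_edgeSet`), the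
one-sided continuity of the densities (FO-10a-g335s `BoxLimitSemicontinuity.lean`: `h⁰(·,q)` left-continuous, `h¹(·,q)`
right-continuous — Prop. (4.28)(b)(c)), the comparison `h¹(p,q) ≤ h⁰(p',q)` for `p < p'` (Literature
`wiredEdgeDensity_le_freeEdgeDensity_of_lt`, Grimmett's (4.73)–(4.76)) and, in contrapositive form, the half (b) ⇒ (c)
(`Literature.Barriers.CriticalPhenomena.RandomClusterFirstOrderEdgeDensityProofs`: `not_continuousAt_freeEdgeDensity_of_lt`,
`not_continuousAt_wiredEdgeDensity_of_lt` — a jump `h⁰(p) < h¹(p)` makes both densities discontinuous; used there for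
the Thm. (7.33)(a) barrier, not imported here to keep the Pirogov–Sinai closure out of this file). NEW here: the converse
(c) ⇒ (b) and the values of the one-sided limits, whence the two-sided statement (b) ⟺ (c) ⟺ (d):

* `tendsto_freeEdgeDensity_nhdsGT` — **`h⁰(x,q) → h¹(p,q)` as `x ↓ p`**: the right limit of the free edge density is the
  WIRED edge density (`h¹(p) ≤ h⁰(x) ≤ h¹(x) → h¹(p)`); `tendsto_wiredEdgeDensity_nhdsLT` — **`h¹(x,q) → h⁰(p,q)` as `x ↑ p`**;
* `continuousAt_freeEdgeDensity_iff`, `continuousAt_wiredEdgeDensity_iff` — **`h^b(·,q)` is continuous at `p` iff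
  `h⁰(p,q) = h¹(p,q)`** (the jump of either density at `p` is `h¹(p,q) − h⁰(p,q)`);
* `rcLimit_false_eq_rcLimit_true_iff_continuousAt_freeEdgeDensity` / `…_wiredEdgeDensity` — **Thm. (4.63) (b) ⟺ (d)**:
  `φ⁰_{p,q} = φ¹_{p,q}` iff the edge density is continuous at `p` ("no latent heat at `p`").

Honest framing: unconditional infinite-volume structure; decides nothing about `p_c(q)` for `q ∈ (1,2)`; NOT a binder
discharge, NOT `_r4`. The percolation-probability form (Thm. (5.16)(c): `θ⁰ = θ¹` iff the density is continuous) is the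
companion `LatentHeatCriterion.lean` (over `UniquenessOfEqualTheta.lean`).

## References
* G. Grimmett, *The Random-Cluster Model*, Springer 2006 (`book:grimmett2006-random-cluster-model`): Prop. (4.28),
  (4.61), Thm. (4.63) and its proof (4.73)–(4.76) [PDF pp. 78, 88–93]. [Grimmett2006]
-/

noncomputable section

open MeasureTheory Set Filter
open scoped Topology ENNReal

namespace Summit.CriticalPhenomena.PercolationContinuityZ3.Theorems.FK

open Literature.Probability.Percolation Literature.Probability.LatticeModels

variable {d : ℕ} {p q : ℝ} {e : Sym2 (Site d)}

/-! ### The one-sided limits: `h⁰(p+) = h¹(p)` and `h¹(p−) = h⁰(p)` -/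

/-- **`h⁰(x,q)(e) → h¹(p,q)(e)` as `x ↓ p`** (`0 < p < 1`, `q ≥ 1`, `e` a lattice edge): the right limit of the free
edge density is the wired edge density, by `h¹(p) ≤ h⁰(x) ≤ h¹(x)` for `x > p` and the right-continuity of `h¹(·,q)`.
[cite: Grimmett2006, proof of Thm. (4.63), (4.73)–(4.76) with Prop. (4.28)(b)] -/
theorem tendsto_freeEdgeDensity_nhdsGT (hd : 0 < d) (hp : p ∈ Set.Ioo (0 : ℝ) 1) (hq : 1 ≤ q)
    (he : e ∈ (zdGraph d).edgeSet) :
    Tendsto (fun x : ℝ => freeEdgeDensity d x q e) (𝓝[>] p) (𝓝 (wiredEdgeDensity d p q e)) := by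
  have hp' : p ∈ Set.Icc (0 : ℝ) 1 := ⟨hp.1.le, hp.2.le⟩
  -- `h¹(x) → h¹(p)` as `x ↓ p`
  have h1 : Tendsto (fun x : ℝ => wiredEdgeDensity d x q e) (𝓝[>] p) (𝓝 (wiredEdgeDensity d p q e)) := by
    have h := continuousWithinAt_Icc_wiredEdgeDensity hd hq e hp'
    rw [ContinuousWithinAt] at h
    rw [← nhdsWithin_Ioc_eq_nhdsGT hp.2]
    exact h.mono_left (nhdsWithin_mono _ Set.Ioc_subset_Icc_self)
  have hmem : Set.Ioo p 1 ∈ 𝓝[>] p := Ioo_mem_nhdsGT hp.2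
  refine tendsto_of_tendsto_of_tendsto_of_le_of_le' tendsto_const_nhds h1 ?_ ?_
  · filter_upwards [hmem] with x hx
    exact wiredEdgeDensity_le_freeEdgeDensity_of_lt hd hp.1 hx.1 hx.2 hq he
  · filter_upwards [hmem] with x hx
    exact freeEdgeDensity_le_wiredEdgeDensity hd ⟨hp.1.le.trans hx.1.le, hx.2.le⟩ hq e

/-- **`h¹(x,q)(e) → h⁰(p,q)(e)` as `x ↑ p`** (`0 < p < 1`, `q ≥ 1`, `e` a lattice edge): the left limit of the wired
edge density is the free edge density, by `h⁰(x) ≤ h¹(x) ≤ h⁰(p)` for `0 < x < p` and the left-continuity of `h⁰(·,q)`.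
[cite: Grimmett2006, proof of Thm. (4.63), (4.73)–(4.76) with Prop. (4.28)(c)] -/
theorem tendsto_wiredEdgeDensity_nhdsLT (hd : 0 < d) (hp : p ∈ Set.Ioo (0 : ℝ) 1) (hq : 1 ≤ q)
    (he : e ∈ (zdGraph d).edgeSet) :
    Tendsto (fun x : ℝ => wiredEdgeDensity d x q e) (𝓝[<] p) (𝓝 (freeEdgeDensity d p q e)) := by
  have hp' : p ∈ Set.Icc (0 : ℝ) 1 := ⟨hp.1.le, hp.2.le⟩
  -- `h⁰(x) → h⁰(p)` as `x ↑ p`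
  have h0 : Tendsto (fun x : ℝ => freeEdgeDensity d x q e) (𝓝[<] p) (𝓝 (freeEdgeDensity d p q e)) := by
    have h := continuousWithinAt_Icc_freeEdgeDensity hq e hp'
    rw [ContinuousWithinAt] at h
    rw [← nhdsWithin_Ico_eq_nhdsLT hp.1]
    exact h.mono_left (nhdsWithin_mono _ Set.Ico_subset_Icc_self)
  have hmem : Set.Ioo 0 p ∈ 𝓝[<] p := Ioo_mem_nhdsLT hp.1
  refine tendsto_of_tendsto_of_tendsto_of_le_of_le' h0 tendsto_const_nhds ?_ ?_
  · filter_upwards [hmem] with x hx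
    exact freeEdgeDensity_le_wiredEdgeDensity hd ⟨hx.1.le, (hx.2.trans hp.2).le⟩ hq e
  · filter_upwards [hmem] with x hx
    exact wiredEdgeDensity_le_freeEdgeDensity_of_lt hd hx.1 hx.2 hp.2 hq he

/-! ### Thm. (4.63) (b) ⟺ (c): continuity of the edge density at `p` iff `h⁰(p,q) = h¹(p,q)` -/

/-- **Thm. (4.63) (b)(i) ⟺ (c)**: `x ↦ h⁰(x,q)(e)` is continuous at `p` iff `h⁰(p,q)(e) = h¹(p,q)(e)` (`0 < p < 1`,
`q ≥ 1`, `e` a lattice edge) — `h⁰(·,q)` is left-continuous and its right limit at `p` is `h¹(p,q)`. (The ⇒ half is,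
contrapositively, the Literature barrier file's `not_continuousAt_freeEdgeDensity_of_lt`; the ⇐ half is new.)
[cite: Grimmett2006, Thm. (4.63) ((b)(i) ⟺ (c))] -/
theorem continuousAt_freeEdgeDensity_iff (hd : 0 < d) (hp : p ∈ Set.Ioo (0 : ℝ) 1) (hq : 1 ≤ q)
    (he : e ∈ (zdGraph d).edgeSet) :
    ContinuousAt (fun x : ℝ => freeEdgeDensity d x q e) p ↔ freeEdgeDensity d p q e = wiredEdgeDensity d p q e := by
  have hp' : p ∈ Set.Icc (0 : ℝ) 1 := ⟨hp.1.le, hp.2.le⟩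
  have hright := tendsto_freeEdgeDensity_nhdsGT hd hp hq he
  constructor
  · intro hc
    exact tendsto_nhds_unique (hc.tendsto.mono_left nhdsWithin_le_nhds) hright
  · intro heq
    rw [continuousAt_iff_continuous_left'_right']
    refine ⟨?_, ?_⟩
    · exact ((continuousWithinAt_Icc_iff_Iic hp.1).1 (continuousWithinAt_Icc_freeEdgeDensity hq e hp')).mono
        Set.Iio_subset_Iic_self
    · rw [ContinuousWithinAt, heq]
      exact hright

/-- **Thm. (4.63) (b)(ii) ⟺ (c)**: `x ↦ h¹(x,q)(e)` is continuous at `p` iff `h⁰(p,q)(e) = h¹(p,q)(e)` (`0 < p < 1`,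
`q ≥ 1`, `e` a lattice edge) — `h¹(·,q)` is right-continuous and its left limit at `p` is `h⁰(p,q)`. (The ⇒ half is,
contrapositively, the Literature barrier file's `not_continuousAt_wiredEdgeDensity_of_lt`; the ⇐ half is new.)
[cite: Grimmett2006, Thm. (4.63) ((b)(ii) ⟺ (c))] -/
theorem continuousAt_wiredEdgeDensity_iff (hd : 0 < d) (hp : p ∈ Set.Ioo (0 : ℝ) 1) (hq : 1 ≤ q)
    (he : e ∈ (zdGraph d).edgeSet) :
    ContinuousAt (fun x : ℝ => wiredEdgeDensity d x q e) p ↔ freeEdgeDensity d p q e = wiredEdgeDensity d p q e := by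
  have hp' : p ∈ Set.Icc (0 : ℝ) 1 := ⟨hp.1.le, hp.2.le⟩
  have hleft := tendsto_wiredEdgeDensity_nhdsLT hd hp hq he
  constructor
  · intro hc
    exact (tendsto_nhds_unique (hc.tendsto.mono_left nhdsWithin_le_nhds) hleft).symm
  · intro heq
    rw [continuousAt_iff_continuous_left'_right']
    refine ⟨?_, ?_⟩
    · rw [ContinuousWithinAt, ← heq]
      exact hleft
    · exact ((continuousWithinAt_Icc_iff_Ici hp.2).1 (continuousWithinAt_Icc_wiredEdgeDensity hd hq e hp')).mono
        Set.Ioi_subset_Ici_self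

/-- The two densities are continuous at the same points of `(0,1)`. [cite: Grimmett2006, Thm. (4.63) ((b)(i) ⟺ (b)(ii))] -/
theorem continuousAt_freeEdgeDensity_iff_continuousAt_wiredEdgeDensity (hd : 0 < d) (hp : p ∈ Set.Ioo (0 : ℝ) 1)
    (hq : 1 ≤ q) (he : e ∈ (zdGraph d).edgeSet) :
    ContinuousAt (fun x : ℝ => freeEdgeDensity d x q e) p ↔ ContinuousAt (fun x : ℝ => wiredEdgeDensity d x q e) p := by
  rw [continuousAt_freeEdgeDensity_iff hd hp hq he, continuousAt_wiredEdgeDensity_iff hd hp hq he]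

/-! ### Thm. (4.63) (b) ⟺ (d): `φ⁰_{p,q} = φ¹_{p,q}` iff the edge density is continuous at `p` -/

/-- **Grimmett 2006, Thm. (4.63) (b)(i) ⟺ (d)**: for `0 < p < 1`, `q ≥ 1` and any lattice edge `e` of `ℤ^d`,
`φ⁰_{p,q} = φ¹_{p,q}` **iff** the free edge density `x ↦ h⁰(x,q)(e)` is continuous at `x = p` ("no latent heat").
[cite: Grimmett2006, Thm. (4.63)] -/
theorem rcLimit_false_eq_rcLimit_true_iff_continuousAt_freeEdgeDensity (hp : p ∈ Set.Ioo (0 : ℝ) 1) (hq : 1 ≤ q)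
    (he : e ∈ (zdGraph d).edgeSet) :
    rcLimit d false p q = rcLimit d true p q ↔ ContinuousAt (fun x : ℝ => freeEdgeDensity d x q e) p := by
  obtain ⟨i, -, -⟩ := exists_eq_map_add_of_mem_edgeSet he
  have hd : 0 < d := i.pos
  rw [rcLimit_false_eq_rcLimit_true_iff_of_mem_edgeSet ⟨hp.1.le, hp.2.le⟩ hq he,
    continuousAt_freeEdgeDensity_iff hd hp hq he]

/-- **Thm. (4.63) (b)(ii) ⟺ (d)**: `φ⁰_{p,q} = φ¹_{p,q}` iff the wired edge density `x ↦ h¹(x,q)(e)` is continuous at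
`p` (`0 < p < 1`, `q ≥ 1`, `e` a lattice edge). [cite: Grimmett2006, Thm. (4.63)] -/
theorem rcLimit_false_eq_rcLimit_true_iff_continuousAt_wiredEdgeDensity (hp : p ∈ Set.Ioo (0 : ℝ) 1) (hq : 1 ≤ q)
    (he : e ∈ (zdGraph d).edgeSet) :
    rcLimit d false p q = rcLimit d true p q ↔ ContinuousAt (fun x : ℝ => wiredEdgeDensity d x q e) p := by
  obtain ⟨i, -, -⟩ := exists_eq_map_add_of_mem_edgeSet he
  have hd : 0 < d := i.pos
  rw [rcLimit_false_eq_rcLimit_true_iff_of_mem_edgeSet ⟨hp.1.le, hp.2.le⟩ hq he,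
    continuousAt_wiredEdgeDensity_iff hd hp hq he]

/-- **The jump of the edge density is the free/wired gap**: at a parameter `p ∈ (0,1)` where `φ⁰_{p,q} ≠ φ¹_{p,q}`
(`q ≥ 1`), BOTH densities are discontinuous at `p` — `h⁰(·,q)` jumps up to `h¹(p,q)` from the right, `h¹(·,q)` jumps
down to `h⁰(p,q)` from the left. [cite: Grimmett2006, Thm. (4.63) and (4.61)] -/
theorem not_continuousAt_edgeDensity_of_rcLimit_false_ne_rcLimit_true (hp : p ∈ Set.Ioo (0 : ℝ) 1) (hq : 1 ≤ q)
    (he : e ∈ (zdGraph d).edgeSet) (h : rcLimit d false p q ≠ rcLimit d true p q) :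
    ¬ ContinuousAt (fun x : ℝ => freeEdgeDensity d x q e) p ∧ ¬ ContinuousAt (fun x : ℝ => wiredEdgeDensity d x q e) p :=
  ⟨fun hc => h ((rcLimit_false_eq_rcLimit_true_iff_continuousAt_freeEdgeDensity hp hq he).2 hc),
    fun hc => h ((rcLimit_false_eq_rcLimit_true_iff_continuousAt_wiredEdgeDensity hp hq he).2 hc)⟩

end Summit.CriticalPhenomena.PercolationContinuityZ3.Theorems.FK

end
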